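import Summits.BirchSwinnertonDyer.BirchSwinnertonDyer.Theorems.GenusKolyvaginAtTwoMinimalTwinBSDTwoKrizLiAnchorsPrintWallSS
import Summits.BirchSwinnertonDyer.BirchSwinnertonDyer.Theorems.GenusKolyvaginAtTwoMinimalTwinBSDTwoKrizLiAnchor43a1RootNumber
import HarnessLib

/-!
# Route `GenusKolyvaginAtTwo`, crux U₂ `MinimalTwinBSDTwo` (stmt-BirchSwinnertonDyer-22985), LINE 23 «twin_swap»: `GenusKolyvaginAtTwoMinimalTwinBSDTwoKrizLiAnchorsPrintWallSS` WITH THE Gross–Zagier–Kolyvagin INPUT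
# DISCHARGED — every theorem of that file carrying `(hGZK : rank_eq_analyticRank_of_analyticRank_le_one)` re-issued with `(hmod : exists_isNewformOf)`, the anchors'
# `r_an = 1` coming from their kernel root numbers (`…KrizLiAnchor<X>RootNumber.lean`, `analyticRank_<X>_of_modularity`, anchors 43a1)

Seat `bsd-line-gk2-p2` g36 (PROVER 2/3, cell `bsd-f1-sign2`; LINE 23 holder), `--supports stmt-BirchSwinnertonDyer-22985` (helper; closes nothing).
THEOREMS ONLY (0 `def`, 0 `sorry`); standard axioms.  Pure re-issue: statements verbatim up to the one binder; the wall rows / route items and the PRINT facts stay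
displayed.  **BSD is NOT proved by any of this; U₂ is NOT proved; no item is closed.**

References: [KrizLi2019] Thm 5.1 (2), Thm 4.3, §6 Table 1; [CreutzMiller2012] Thm 1.1; [CremonaAlgorithms1997] Table 1; [BCDTJAMS2001] Thm. A.
-/

set_option autoImplicit false
-- the Theorems namespace of this sub repeats the summit name by design (D-0017 nested layout)
set_option linter.dupNamespace false

noncomputable section

open scoped Classical

open WeierstrassCurve NumberField Literature.NumberTheory.EllipticCurves
  Literature.NumberTheory.EllipticCurves.ModularForms
  Literature.NumberTheory.EllipticCurves.Rank1Residual
  Literature.NumberTheory.EllipticCurves.Rank1Residual.Typed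
  Literature.NumberTheory.EllipticCurves.X1Eleven
  Summit.BirchSwinnertonDyer.Rank1Residual
  Summit.BirchSwinnertonDyer.Rank1Residual.P2
  Summit.BirchSwinnertonDyer.BirchSwinnertonDyer.Theorems.AddPotGoodPrint
  Summit.BirchSwinnertonDyer.BirchSwinnertonDyer.Theorems.OrdinaryTwistAtTwo
  Summit.BirchSwinnertonDyer.BirchSwinnertonDyer.Theorems.GenusExact.TwinSwap.KrizLiAnchorWall

namespace Summit.BirchSwinnertonDyer.BirchSwinnertonDyer.Theorems.GenusExact.TwinSwap.KrizLiAnchorsPrintWallSS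

open Summit.BirchSwinnertonDyer.BirchSwinnertonDyer.Theorems.GenusExact.TwinSwap.KrizLiAnchor43a1 in
/-- (GZK DISCHARGED: `hmod` = the Modularity Theorem `exists_isNewformOf` replaces `hGZK`; the anchor's `r_an = 1` from its kernel root number.) ★ **PRINT-DECIDED INSTANCES OF THE SUPERSINGULAR RANK-ZERO WALL ROW** (item 19097 / the route's `WallSupersingularRankZeroAtTwo`): at every global minimal
`W₂ ≅ 43a1^{(−7d)}` (`d ∈ 𝒩(43a1, K)`, `d_K = −7`, `χ_d(−N) = 1`): `r_an(W₂) = 0 ∧ ¬CM(W₂) ∧ GoodSS W₂ 2 ∧ BSD(W₂, 2)`, from PRINT + GZK alone (no wall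
item used).  BSD is not proved by any of this; the wall row is NOT proved (these are instances).
[cite: KrizLi2019, Thm. 5.1 (2), Thm. 4.3, §6 Table 1 / Example 6.1–6.2] [cite: CreutzMiller2012, Thm. 1.1] -/
theorem wallSSInstances_43A1_of_modularity (hKL : KrizLi2019.thm112_bsdTwo_twist) (h33 : KrizLi2019.thm33_rank_twist)
    (htab : KrizLi2019.table1_row43a1) (hS31 : bsdTriple_of_analyticRank_le_one_of_conductor_lt) (hmod : exists_isNewformOf)
    (K : Type) [Field K] [NumberField K] (hK : IsImaginaryQuadratic K) (hdK : NumberField.discr K = -7)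
    {d : ℤ} (hd : haveI := KrizLiAnchor43a1.isGloballyMinimal_43A1; KrizLi2019.InN (⟨0, 1, 1, 0, 0⟩ : WeierstrassCurve ℚ) K d)
    (hsign : haveI := KrizLiAnchor43a1.isElliptic_43A1; Int.sign d * jacobiSym ((⟨0, 1, 1, 0, 0⟩ : WeierstrassCurve ℚ).conductorNorm ℤ) d.natAbs = 1)
    (W₂ : WeierstrassCurve ℚ) [W₂.IsElliptic] [W₂.IsGloballyMinimal]
    (hW₂ : ∃ C : VariableChange ℚ, C • (⟨0, 1, 1, 0, 0⟩ : WeierstrassCurve ℚ).quadraticTwist ((-7 * d : ℤ) : ℚ) = W₂) :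
    haveI : Fact (Nat.Prime 2) := ⟨Nat.prime_two⟩
    W₂.analyticRank = 0 ∧ ¬ W₂.HasCM ∧ GoodSS W₂ 2 ∧ BSDp W₂ 2 := by
  haveI := KrizLiAnchor43a1.isElliptic_43A1; haveI := KrizLiAnchor43a1.isGloballyMinimal_43A1
  obtain ⟨hr, hcm, hB⟩ := KrizLiAnchor43a1.printFamily43A1_krizLi_rankZeroCompanions_of_modularity hKL h33 htab hS31 hmod K hK hdK hd hsign W₂ hW₂
  obtain ⟨C, hC⟩ := hW₂
  have h4 : (-7 * d) % 4 = 1 := by rw [Int.mul_emod, hd.1]; decide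
  exact ⟨hr, hcm, goodSS_two_of_smul_quadraticTwist_of_emod_four_eq_one _ W₂ h4 hC goodSS_two_43A1, hB⟩

end Summit.BirchSwinnertonDyer.BirchSwinnertonDyer.Theorems.GenusExact.TwinSwap.KrizLiAnchorsPrintWallSS

end
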